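import Literature.AlgebraicGeometry.Motives.AbelianVarietyPointCountIsogenyInvariance
import Literature.AlgebraicGeometry.Motives.AbelianVarietyGaloisCharpolyIsogenyRelations
import Literature.AlgebraicGeometry.Motives.AbelianVarietyMordellWeilRankIsogenyRelations
import Literature.AlgebraicGeometry.Motives.AbelianVarietyDihedralIdempotentRelations
import HarnessLib

/-!
# The dihedral Kani–Rosen relations `X × B_G² ∼ B_σ × B_τ²` (`n` odd), `X × B_G² ∼ B_σ × B_τ × B_{στ}` (`n` even)
# read on point counts, `ℓ`-adic characteristic polynomials of Galois and Frobenius, traces and Mordell–Weil ranks —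
# with the general readers for an isogeny `X × Y₁ × Y₂ ∼ Z₁ × Z₂ × Z₃`

For a dihedral group `G = ⟨σ, τ⟩` (`|G| = 2n`, `τ² = 1`, `τστ⁻¹ = σ⁻¹`) — more generally a generalized dihedral group
`A ⋊ ⟨τ⟩` with `|A|` odd — acting on an abelian variety `X` over a perfect field through `ρ : G → End X`, the tree proves
the isogenies of Kani–Rosen / Paulhus (5) / Honigs–Sarmah Thm. 4.2 on the algebraic carrier
(`Motives/AbelianVarietyDihedralIdempotentRelations` §4): `X × B_G² ∼ B_σ × B_τ²` for `n` odd
(`isIsogenous_dihedral_odd`, "`J_X × J²_{X/D_{2m}} ∼ J_{X/⟨r⟩} × J²_{X/⟨s⟩}`"), `X × B_G² ∼ B_A × B_τ²` for `A ⋊ ⟨τ⟩`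
with `|A|` odd (`isIsogenous_genDihedral_odd`), and `X × B_G² ∼ B_σ × B_τ × B_{στ}` for `n` even
(`isIsogenous_dihedral_even`), where `B_G = Im N_G`, `B_σ = Im N_⟨σ⟩`, `B_τ = Im N_⟨τ⟩`, `B_{στ} = Im N_⟨στ⟩`
(the quotient-curve reading `B_H ∼ J_{X/H}` is not asserted).

§1 provides, once and for all, the READERS of an isogeny of the shape `X × (Y₁ × Y₂) ∼ Z₁ × (Z₂ × Z₃)` (the shape of all
these relations, and of the Klein relation of `Motives/AbelianVarietyKleinFourArithmetic`) through the three additive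
isogeny-invariant functors of the generation: `N_m(X) N_m(Y₁) N_m(Y₂) = N_m(Z₁) N_m(Z₂) N_m(Z₃)` over a finite field,
`charpoly(σ | T_ℓ X) charpoly(σ | T_ℓ Y₁) charpoly(σ | T_ℓ Y₂) = charpoly(σ | T_ℓ Z₁) charpoly(σ | T_ℓ Z₂) charpoly(σ | T_ℓ Z₃)`
(+ traces), and `rk X(L) + rk Y₁(L) + rk Y₂(L) = rk Z₁(L) + rk Z₂(L) + rk Z₃(L)` (finite ranks on the right suffice);
§2 instantiates them for the dihedral relations:

* **`N_m(X) · N_m(B_G)² = N_m(B_σ) · N_m(B_τ)²`** (`n` odd; for hyperelliptic-type configurations the count behind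
  "`#J_C · #J_{C/D_n}² = #J_{C/σ} · #J_{C/τ}²`"), `N_m(X) · N_m(B_G)² = N_m(B_σ) N_m(B_τ) N_m(B_{στ})` (`n` even);
* the same for `charpoly(φ | T_ℓ ·)` of every `φ ∈ Gal(K̄/K)`, for Milne's characteristic polynomials of Frobenius and
  for the traces (`Tr(φ | T_ℓ X) + 2 Tr(φ | T_ℓ B_G) = Tr(φ | T_ℓ B_σ) + 2 Tr(φ | T_ℓ B_τ)`);
* **`rk X(L) + 2 rk B_G(L) = rk B_σ(L) + 2 rk B_τ(L)`** (`n` odd), `rk X(L) + 2 rk B_G(L) = rk B_σ(L) + rk B_τ(L) + rk B_{στ}(L)`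
  (`n` even) for the Mordell–Weil groups over any `L/K`.

## Main statements (sorry-free; theorems only, no new definitions)

* §1 readers: `pointCount_eq_of_isIsogenous_biprod_three`, `charpoly_tateRep_eq_of_isIsogenous_biprod_three`,
  `trace_tateRep_eq_of_isIsogenous_biprod_three`, `module_finite_points_of_isIsogenous_biprod_three`,
  `finrank_points_eq_of_isIsogenous_biprod_three`.
* §2 dihedral: `pointCount_dihedral_odd`, `pointCount_genDihedral_odd`, `pointCount_dihedral_even`,
  `charpoly_tateRep_dihedral_odd`, `charpoly_tateRep_dihedral_even`, `trace_tateRep_dihedral_odd`,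
  `charpoly_frobenius_dihedral_odd`, `finrank_points_dihedral_odd`, `finrank_points_genDihedral_odd`,
  `finrank_points_dihedral_even`.

Scope (stated, not hidden).  Perfect (resp. finite) base field; `ℓ ≠ char K`; the subgroups `⟨σ⟩, ⟨τ⟩, ⟨στ⟩, A` carry
`Fintype` instances and enter through their norm elements; no curves, no `L`-functions.

## References

* [Paulhus2008] J. Paulhus, *Decomposing Jacobians of curves with extra automorphisms*, Acta Arith. 132 (2008), §3.1.2 (5) (p. 236).
* [HonigsSarmah2025] (as cited in `Motives/AbelianVarietyDihedralIdempotentRelations`), §4 Thm. 4.2, Thm. 4.3.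
* [KaniRosen1989] E. Kani, M. Rosen, *Idempotent relations and factors of Jacobians*, Math. Ann. 284 (1989), Thm. B.
* [Tate1966Endomorphisms] J. Tate, *Endomorphisms of abelian varieties over finite fields* (1966), §1 Thm. 1.
* [Milne1986AbelianVarieties] J. S. Milne, *Abelian varieties* (1986), §19 Thm. 19.1 and its proof (pp. 143–145).
* [MumfordAV1970] D. Mumford, *Abelian Varieties* (1970), §19 (pp. 169, 176, 180).
* [DokchitserEtAl2022] V. Dokchitser, H. Green, A. Konstantinou, A. Morgan, *Parity of ranks of Jacobians of curves* (2022), §1.3, §3.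
-/

noncomputable section

open CategoryTheory CategoryTheory.Limits
open scoped TensorProduct
open Literature.NumberTheory.DiophantineGeometry

universe u

namespace Literature.AlgebraicGeometry.Motives

namespace AbelianVariety

/-! ## §1 Readers for an isogeny `X × (Y₁ × Y₂) ∼ Z₁ × (Z₂ × Z₃)` -/

section Readers

variable {K : Type u} [Field K] {X Y₁ Y₂ Z₁ Z₂ Z₃ : AbelianVariety K}

/-- **Point counts**: `X × (Y₁ × Y₂) ∼ Z₁ × (Z₂ × Z₃)` over a finite field gives
`N_m(X) N_m(Y₁) N_m(Y₂) = N_m(Z₁) N_m(Z₂) N_m(Z₃)` for `m ≥ 1`. [cite: Tate1966Endomorphisms, §1 Thm. 1]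
[cite: Milne1986AbelianVarieties, §19, proof of Thm. 19.1 (p. 145)] -/
theorem pointCount_eq_of_isIsogenous_biprod_three [Finite K] (h : IsIsogenous (X ⊞ (Y₁ ⊞ Y₂)) (Z₁ ⊞ (Z₂ ⊞ Z₃)))
    {m : ℕ} (hm : 0 < m) :
    pointCount X.X m * (pointCount Y₁.X m * pointCount Y₂.X m) =
      pointCount Z₁.X m * (pointCount Z₂.X m * pointCount Z₃.X m) := by
  simpa only [pointCount_biprod _ _ hm] using h.pointCount_eq hm

variable (ℓ : ℕ) [Fact ℓ.Prime]

/-- **`ℓ`-adic characteristic polynomials**: `X × (Y₁ × Y₂) ∼ Z₁ × (Z₂ × Z₃)` gives, for `ℓ` invertible in `K` and every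
`φ ∈ Gal(K̄/K)`, `∏ charpoly(φ | T_ℓ ·)` of the left factors `=` that of the right factors (instances from the tree's
theorems). [cite: Tate1966Endomorphisms, §1] [cite: MumfordAV1970, §19 p. 176] -/
theorem charpoly_tateRep_eq_of_isIsogenous_biprod_three (h : IsIsogenous (X ⊞ (Y₁ ⊞ Y₂)) (Z₁ ⊞ (Z₂ ⊞ Z₃)))
    (hℓ : (ℓ : K) ≠ 0) (φ : Field.absoluteGaloisGroup K) :
    haveI := X.module_free_tateModule_holds ℓ hℓ
    haveI := module_finite_tateModule_of_cast_ne_zero X ℓ hℓ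
    haveI := Y₁.module_free_tateModule_holds ℓ hℓ
    haveI := module_finite_tateModule_of_cast_ne_zero Y₁ ℓ hℓ
    haveI := Y₂.module_free_tateModule_holds ℓ hℓ
    haveI := module_finite_tateModule_of_cast_ne_zero Y₂ ℓ hℓ
    haveI := Z₁.module_free_tateModule_holds ℓ hℓ
    haveI := module_finite_tateModule_of_cast_ne_zero Z₁ ℓ hℓ
    haveI := Z₂.module_free_tateModule_holds ℓ hℓ
    haveI := module_finite_tateModule_of_cast_ne_zero Z₂ ℓ hℓ
    haveI := Z₃.module_free_tateModule_holds ℓ hℓ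
    haveI := module_finite_tateModule_of_cast_ne_zero Z₃ ℓ hℓ
    (X.tateRep ℓ φ).charpoly * ((Y₁.tateRep ℓ φ).charpoly * (Y₂.tateRep ℓ φ).charpoly) =
      (Z₁.tateRep ℓ φ).charpoly * ((Z₂.tateRep ℓ φ).charpoly * (Z₃.tateRep ℓ φ).charpoly) := by
  haveI := X.module_free_tateModule_holds ℓ hℓ
  haveI := module_finite_tateModule_of_cast_ne_zero X ℓ hℓ
  haveI := Y₁.module_free_tateModule_holds ℓ hℓ
  haveI := module_finite_tateModule_of_cast_ne_zero Y₁ ℓ hℓ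
  haveI := Y₂.module_free_tateModule_holds ℓ hℓ
  haveI := module_finite_tateModule_of_cast_ne_zero Y₂ ℓ hℓ
  haveI := Z₁.module_free_tateModule_holds ℓ hℓ
  haveI := module_finite_tateModule_of_cast_ne_zero Z₁ ℓ hℓ
  haveI := Z₂.module_free_tateModule_holds ℓ hℓ
  haveI := module_finite_tateModule_of_cast_ne_zero Z₂ ℓ hℓ
  haveI := Z₃.module_free_tateModule_holds ℓ hℓ
  haveI := module_finite_tateModule_of_cast_ne_zero Z₃ ℓ hℓ
  haveI := (Y₁ ⊞ Y₂).module_free_tateModule_holds ℓ hℓ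
  haveI := module_finite_tateModule_of_cast_ne_zero (Y₁ ⊞ Y₂) ℓ hℓ
  haveI := (X ⊞ (Y₁ ⊞ Y₂)).module_free_tateModule_holds ℓ hℓ
  haveI := module_finite_tateModule_of_cast_ne_zero (X ⊞ (Y₁ ⊞ Y₂)) ℓ hℓ
  haveI := (Z₂ ⊞ Z₃).module_free_tateModule_holds ℓ hℓ
  haveI := module_finite_tateModule_of_cast_ne_zero (Z₂ ⊞ Z₃) ℓ hℓ
  haveI := (Z₁ ⊞ (Z₂ ⊞ Z₃)).module_free_tateModule_holds ℓ hℓ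
  haveI := module_finite_tateModule_of_cast_ne_zero (Z₁ ⊞ (Z₂ ⊞ Z₃)) ℓ hℓ
  have key := h.charpoly_tateRep_eq' hℓ φ
  rw [charpoly_tateRep_biprod_of_natCast_ne_zero ℓ _ _ hℓ φ, charpoly_tateRep_biprod_of_natCast_ne_zero ℓ _ _ hℓ φ,
    charpoly_tateRep_biprod_of_natCast_ne_zero ℓ _ _ hℓ φ, charpoly_tateRep_biprod_of_natCast_ne_zero ℓ _ _ hℓ φ] at key
  exact key

/-- **Traces**: `X × (Y₁ × Y₂) ∼ Z₁ × (Z₂ × Z₃)` gives `Tr(φ|T_ℓ X) + Tr(φ|T_ℓ Y₁) + Tr(φ|T_ℓ Y₂) = Tr(φ|T_ℓ Z₁) + Tr(φ|T_ℓ Z₂) +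
Tr(φ|T_ℓ Z₃)` (`ℓ` invertible in `K`). [cite: Tate1966Endomorphisms, §1] [cite: MumfordAV1970, §19 Thm. 4 (p. 180)] -/
theorem trace_tateRep_eq_of_isIsogenous_biprod_three (h : IsIsogenous (X ⊞ (Y₁ ⊞ Y₂)) (Z₁ ⊞ (Z₂ ⊞ Z₃)))
    (hℓ : (ℓ : K) ≠ 0) (φ : Field.absoluteGaloisGroup K) :
    LinearMap.trace ℤ_[ℓ] _ (X.tateRep ℓ φ) +
        (LinearMap.trace ℤ_[ℓ] _ (Y₁.tateRep ℓ φ) + LinearMap.trace ℤ_[ℓ] _ (Y₂.tateRep ℓ φ)) =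
      LinearMap.trace ℤ_[ℓ] _ (Z₁.tateRep ℓ φ) +
        (LinearMap.trace ℤ_[ℓ] _ (Z₂.tateRep ℓ φ) + LinearMap.trace ℤ_[ℓ] _ (Z₃.tateRep ℓ φ)) := by
  haveI := X.module_free_tateModule_holds ℓ hℓ
  haveI := module_finite_tateModule_of_cast_ne_zero X ℓ hℓ
  haveI := Y₁.module_free_tateModule_holds ℓ hℓ
  haveI := module_finite_tateModule_of_cast_ne_zero Y₁ ℓ hℓ
  haveI := Y₂.module_free_tateModule_holds ℓ hℓ
  haveI := module_finite_tateModule_of_cast_ne_zero Y₂ ℓ hℓ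
  haveI := Z₁.module_free_tateModule_holds ℓ hℓ
  haveI := module_finite_tateModule_of_cast_ne_zero Z₁ ℓ hℓ
  haveI := Z₂.module_free_tateModule_holds ℓ hℓ
  haveI := module_finite_tateModule_of_cast_ne_zero Z₂ ℓ hℓ
  haveI := Z₃.module_free_tateModule_holds ℓ hℓ
  haveI := module_finite_tateModule_of_cast_ne_zero Z₃ ℓ hℓ
  have key := congrArg Polynomial.nextCoeff (charpoly_tateRep_eq_of_isIsogenous_biprod_three ℓ h hℓ φ)
  rw [Polynomial.Monic.nextCoeff_mul (LinearMap.charpoly_monic _)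
      ((LinearMap.charpoly_monic _).mul (LinearMap.charpoly_monic _)),
    Polynomial.Monic.nextCoeff_mul (LinearMap.charpoly_monic _) (LinearMap.charpoly_monic _),
    Polynomial.Monic.nextCoeff_mul (LinearMap.charpoly_monic _)
      ((LinearMap.charpoly_monic _).mul (LinearMap.charpoly_monic _)),
    Polynomial.Monic.nextCoeff_mul (LinearMap.charpoly_monic _) (LinearMap.charpoly_monic _)] at key
  simp only [trace_eq_neg_nextCoeff_charpoly]
  linear_combination -key

omit [Fact ℓ.Prime] in
/-- **Finiteness of `X(L) ⊗ ℚ` from the right-hand side**: if `X × (Y₁ × Y₂) ∼ Z₁ × (Z₂ × Z₃)` and the `Z_i(L) ⊗ ℚ` are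
finite-dimensional, so is `X(L) ⊗ ℚ` (a direct factor of a space isomorphic to `⊕ Z_i(L) ⊗ ℚ`).
[cite: MumfordAV1970, §19 Remark p. 169] [cite: DokchitserEtAl2022, §3 (additive functor lemma)] -/
theorem module_finite_points_of_isIsogenous_biprod_three (h : IsIsogenous (X ⊞ (Y₁ ⊞ Y₂)) (Z₁ ⊞ (Z₂ ⊞ Z₃)))
    (L : Type u) [Field L] [Algebra K L] [Module.Finite ℚ (ℚ ⊗[ℤ] Additive (Z₁.Points L))]
    [Module.Finite ℚ (ℚ ⊗[ℤ] Additive (Z₂.Points L))] [Module.Finite ℚ (ℚ ⊗[ℤ] Additive (Z₃.Points L))] :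
    Module.Finite ℚ (ℚ ⊗[ℤ] Additive (X.Points L)) := by
  haveI := module_finite_points_biprod Z₂ Z₃ L
  haveI := module_finite_points_biprod Z₁ (Z₂ ⊞ Z₃) L
  haveI : Module.Finite ℚ (ℚ ⊗[ℤ] Additive ((X ⊞ (Y₁ ⊞ Y₂)).Points L)) := (h.module_finite_points_iff L).2 inferInstance
  obtain ⟨e⟩ := nonempty_linearEquiv_points_biprod X (Y₁ ⊞ Y₂) L
  refine Module.Finite.of_surjective
    ((LinearMap.fst ℚ (ℚ ⊗[ℤ] Additive (X.Points L)) (ℚ ⊗[ℤ] Additive ((Y₁ ⊞ Y₂).Points L))) ∘ₗ e.toLinearMap)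
    fun x ↦ ⟨e.symm (x, 0), ?_⟩
  simp

omit [Fact ℓ.Prime] in
/-- **Mordell–Weil ranks**: `X × (Y₁ × Y₂) ∼ Z₁ × (Z₂ × Z₃)` gives `rk X(L) + rk Y₁(L) + rk Y₂(L) = rk Z₁(L) + rk Z₂(L) + rk Z₃(L)`
when all the `Y_i(L) ⊗ ℚ`, `Z_i(L) ⊗ ℚ` are finite-dimensional. [cite: MumfordAV1970, §19 Remark p. 169]
[cite: DokchitserEtAl2022, §1 (p. 5) and §3 (additive functor lemma)] -/
theorem finrank_points_eq_of_isIsogenous_biprod_three (h : IsIsogenous (X ⊞ (Y₁ ⊞ Y₂)) (Z₁ ⊞ (Z₂ ⊞ Z₃)))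
    (L : Type u) [Field L] [Algebra K L] [Module.Finite ℚ (ℚ ⊗[ℤ] Additive (Y₁.Points L))]
    [Module.Finite ℚ (ℚ ⊗[ℤ] Additive (Y₂.Points L))] [Module.Finite ℚ (ℚ ⊗[ℤ] Additive (Z₁.Points L))]
    [Module.Finite ℚ (ℚ ⊗[ℤ] Additive (Z₂.Points L))] [Module.Finite ℚ (ℚ ⊗[ℤ] Additive (Z₃.Points L))] :
    Module.finrank ℚ (ℚ ⊗[ℤ] Additive (X.Points L)) +
        (Module.finrank ℚ (ℚ ⊗[ℤ] Additive (Y₁.Points L)) + Module.finrank ℚ (ℚ ⊗[ℤ] Additive (Y₂.Points L))) =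
      Module.finrank ℚ (ℚ ⊗[ℤ] Additive (Z₁.Points L)) +
        (Module.finrank ℚ (ℚ ⊗[ℤ] Additive (Z₂.Points L)) + Module.finrank ℚ (ℚ ⊗[ℤ] Additive (Z₃.Points L))) := by
  haveI := module_finite_points_of_isIsogenous_biprod_three h L
  haveI := module_finite_points_biprod Y₁ Y₂ L
  haveI := module_finite_points_biprod Z₂ Z₃ L
  have key := h.finrank_points_eq L
  simpa only [finrank_points_biprod] using key

end Readers

/-! ## §2 The dihedral relations read on the invariants -/

section Dihedral

variable {K : Type u} [Field K] {X : AbelianVariety K} {G : Type} [Group G] [Fintype G] (ρ : G →* End X)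
  {A : Subgroup G} [Fintype A] {σ τ : G} {N NA NS NT NST : X ⟶ X}

/-- **`N_m(X) · N_m(B_G)² = N_m(B_σ) · N_m(B_τ)²`** over a finite field for a dihedral action with `n = |σ|` odd (`m ≥ 1`).
[cite: Paulhus2008, §3.1.2 (5) (p. 236)] [cite: KaniRosen1989, Thm. B] [cite: Tate1966Endomorphisms, §1 Thm. 1] -/
theorem pointCount_dihedral_odd [Finite K] [Fintype (Subgroup.zpowers σ)] [Fintype (Subgroup.zpowers τ)]
    (hG : Fintype.card G = 2 * orderOf σ) (hodd : Odd (orderOf σ)) (hτ : orderOf τ = 2) (hστ : τ * σ * τ⁻¹ = σ⁻¹)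
    (hN : End.of N = ∑ g, ρ g) (hNS : End.of NS = ∑ h : Subgroup.zpowers σ, ρ h)
    (hNT : End.of NT = ∑ h : Subgroup.zpowers τ, ρ h) {m : ℕ} (hm : 0 < m) :
    pointCount X.X m * pointCount (image N).X m ^ 2 = pointCount (image NS).X m * pointCount (image NT).X m ^ 2 := by
  haveI : PerfectField K := PerfectField.ofFinite
  rw [sq, sq]
  exact pointCount_eq_of_isIsogenous_biprod_three (isIsogenous_dihedral_odd ρ hG hodd hτ hστ hN hNS hNT) hm

/-- **`N_m(X) · N_m(B_G)² = N_m(B_A) · N_m(B_τ)²`** over a finite field for a generalized dihedral group `A ⋊ ⟨τ⟩` with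
`|A|` odd (`m ≥ 1`). [cite: HonigsSarmah2025, §4 Thm. 4.2 (d odd) and Thm. 4.3] [cite: KaniRosen1989, Thm. B] [cite: Tate1966Endomorphisms, §1 Thm. 1] -/
theorem pointCount_genDihedral_odd [Finite K] [Fintype (Subgroup.zpowers τ)] (hG : Fintype.card G = 2 * Fintype.card A)
    (hodd : Odd (Fintype.card A)) (hτ : orderOf τ = 2) (hA : ∀ a ∈ A, τ * a * τ⁻¹ = a⁻¹) (hτA : τ ∉ A)
    (hN : End.of N = ∑ g, ρ g) (hNA : End.of NA = ∑ h : A, ρ h) (hNT : End.of NT = ∑ h : Subgroup.zpowers τ, ρ h)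
    {m : ℕ} (hm : 0 < m) :
    pointCount X.X m * pointCount (image N).X m ^ 2 = pointCount (image NA).X m * pointCount (image NT).X m ^ 2 := by
  haveI : PerfectField K := PerfectField.ofFinite
  rw [sq, sq]
  exact pointCount_eq_of_isIsogenous_biprod_three (isIsogenous_genDihedral_odd ρ hG hodd hτ hA hτA hN hNA hNT) hm

/-- **`N_m(X) · N_m(B_G)² = N_m(B_σ) · N_m(B_τ) · N_m(B_{στ})`** over a finite field for a dihedral action with `n = |σ|`
even (`m ≥ 1`). [cite: HonigsSarmah2025, §4 Thm. 4.2 (d even)] [cite: KaniRosen1989, Thm. B] [cite: Tate1966Endomorphisms, §1 Thm. 1] -/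
theorem pointCount_dihedral_even [Finite K] [Fintype (Subgroup.zpowers σ)] [Fintype (Subgroup.zpowers τ)]
    [Fintype (Subgroup.zpowers (σ * τ))] (hG : Fintype.card G = 2 * orderOf σ) (heven : Even (orderOf σ))
    (hτ : orderOf τ = 2) (hστ : τ * σ * τ⁻¹ = σ⁻¹) (hτσ : τ ∉ Subgroup.zpowers σ) (hN : End.of N = ∑ g, ρ g)
    (hNS : End.of NS = ∑ h : Subgroup.zpowers σ, ρ h) (hNT : End.of NT = ∑ h : Subgroup.zpowers τ, ρ h)
    (hNST : End.of NST = ∑ h : Subgroup.zpowers (σ * τ), ρ h) {m : ℕ} (hm : 0 < m) :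
    pointCount X.X m * pointCount (image N).X m ^ 2 =
      pointCount (image NS).X m * (pointCount (image NT).X m * pointCount (image NST).X m) := by
  haveI : PerfectField K := PerfectField.ofFinite
  rw [sq]
  exact pointCount_eq_of_isIsogenous_biprod_three
    (isIsogenous_dihedral_even ρ hG heven hτ hστ hτσ hN hNS hNT hNST) hm

variable [PerfectField K] (ℓ : ℕ) [Fact ℓ.Prime]

/-- **`charpoly(φ | T_ℓ X) · charpoly(φ | T_ℓ B_G)² = charpoly(φ | T_ℓ B_σ) · charpoly(φ | T_ℓ B_τ)²`** in `ℤ_ℓ[X]` for a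
dihedral action with `n` odd, every `φ ∈ Gal(K̄/K)`, `ℓ` invertible in the perfect field `K`.
[cite: Paulhus2008, §3.1.2 (5) (p. 236)] [cite: KaniRosen1989, Thm. B] [cite: Tate1966Endomorphisms, §1] -/
theorem charpoly_tateRep_dihedral_odd [Fintype (Subgroup.zpowers σ)] [Fintype (Subgroup.zpowers τ)]
    (hG : Fintype.card G = 2 * orderOf σ) (hodd : Odd (orderOf σ)) (hτ : orderOf τ = 2) (hστ : τ * σ * τ⁻¹ = σ⁻¹)
    (hN : End.of N = ∑ g, ρ g) (hNS : End.of NS = ∑ h : Subgroup.zpowers σ, ρ h)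
    (hNT : End.of NT = ∑ h : Subgroup.zpowers τ, ρ h) (hℓ : (ℓ : K) ≠ 0) (φ : Field.absoluteGaloisGroup K) :
    haveI := X.module_free_tateModule_holds ℓ hℓ
    haveI := module_finite_tateModule_of_cast_ne_zero X ℓ hℓ
    haveI := (image N).module_free_tateModule_holds ℓ hℓ
    haveI := module_finite_tateModule_of_cast_ne_zero (image N) ℓ hℓ
    haveI := (image NS).module_free_tateModule_holds ℓ hℓ
    haveI := module_finite_tateModule_of_cast_ne_zero (image NS) ℓ hℓ
    haveI := (image NT).module_free_tateModule_holds ℓ hℓ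
    haveI := module_finite_tateModule_of_cast_ne_zero (image NT) ℓ hℓ
    (X.tateRep ℓ φ).charpoly * ((image N).tateRep ℓ φ).charpoly ^ 2 =
      ((image NS).tateRep ℓ φ).charpoly * ((image NT).tateRep ℓ φ).charpoly ^ 2 := by
  haveI := X.module_free_tateModule_holds ℓ hℓ
  haveI := module_finite_tateModule_of_cast_ne_zero X ℓ hℓ
  haveI := (image N).module_free_tateModule_holds ℓ hℓ
  haveI := module_finite_tateModule_of_cast_ne_zero (image N) ℓ hℓ
  haveI := (image NS).module_free_tateModule_holds ℓ hℓ
  haveI := module_finite_tateModule_of_cast_ne_zero (image NS) ℓ hℓ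
  haveI := (image NT).module_free_tateModule_holds ℓ hℓ
  haveI := module_finite_tateModule_of_cast_ne_zero (image NT) ℓ hℓ
  rw [sq, sq]
  exact charpoly_tateRep_eq_of_isIsogenous_biprod_three ℓ (isIsogenous_dihedral_odd ρ hG hodd hτ hστ hN hNS hNT) hℓ φ

/-- **`charpoly(φ | T_ℓ X) · charpoly(φ | T_ℓ B_G)² = charpoly(φ | T_ℓ B_σ) · charpoly(φ | T_ℓ B_τ) · charpoly(φ | T_ℓ B_{στ})`**
for a dihedral action with `n` even. [cite: HonigsSarmah2025, §4 Thm. 4.2 (d even)] [cite: KaniRosen1989, Thm. B] [cite: Tate1966Endomorphisms, §1] -/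
theorem charpoly_tateRep_dihedral_even [Fintype (Subgroup.zpowers σ)] [Fintype (Subgroup.zpowers τ)]
    [Fintype (Subgroup.zpowers (σ * τ))] (hG : Fintype.card G = 2 * orderOf σ) (heven : Even (orderOf σ))
    (hτ : orderOf τ = 2) (hστ : τ * σ * τ⁻¹ = σ⁻¹) (hτσ : τ ∉ Subgroup.zpowers σ) (hN : End.of N = ∑ g, ρ g)
    (hNS : End.of NS = ∑ h : Subgroup.zpowers σ, ρ h) (hNT : End.of NT = ∑ h : Subgroup.zpowers τ, ρ h)
    (hNST : End.of NST = ∑ h : Subgroup.zpowers (σ * τ), ρ h) (hℓ : (ℓ : K) ≠ 0) (φ : Field.absoluteGaloisGroup K) :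
    haveI := X.module_free_tateModule_holds ℓ hℓ
    haveI := module_finite_tateModule_of_cast_ne_zero X ℓ hℓ
    haveI := (image N).module_free_tateModule_holds ℓ hℓ
    haveI := module_finite_tateModule_of_cast_ne_zero (image N) ℓ hℓ
    haveI := (image NS).module_free_tateModule_holds ℓ hℓ
    haveI := module_finite_tateModule_of_cast_ne_zero (image NS) ℓ hℓ
    haveI := (image NT).module_free_tateModule_holds ℓ hℓ
    haveI := module_finite_tateModule_of_cast_ne_zero (image NT) ℓ hℓ
    haveI := (image NST).module_free_tateModule_holds ℓ hℓ
    haveI := module_finite_tateModule_of_cast_ne_zero (image NST) ℓ hℓ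
    (X.tateRep ℓ φ).charpoly * ((image N).tateRep ℓ φ).charpoly ^ 2 =
      ((image NS).tateRep ℓ φ).charpoly * (((image NT).tateRep ℓ φ).charpoly * ((image NST).tateRep ℓ φ).charpoly) := by
  haveI := X.module_free_tateModule_holds ℓ hℓ
  haveI := module_finite_tateModule_of_cast_ne_zero X ℓ hℓ
  haveI := (image N).module_free_tateModule_holds ℓ hℓ
  haveI := module_finite_tateModule_of_cast_ne_zero (image N) ℓ hℓ
  haveI := (image NS).module_free_tateModule_holds ℓ hℓ
  haveI := module_finite_tateModule_of_cast_ne_zero (image NS) ℓ hℓ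
  haveI := (image NT).module_free_tateModule_holds ℓ hℓ
  haveI := module_finite_tateModule_of_cast_ne_zero (image NT) ℓ hℓ
  haveI := (image NST).module_free_tateModule_holds ℓ hℓ
  haveI := module_finite_tateModule_of_cast_ne_zero (image NST) ℓ hℓ
  rw [sq]
  exact charpoly_tateRep_eq_of_isIsogenous_biprod_three ℓ
    (isIsogenous_dihedral_even ρ hG heven hτ hστ hτσ hN hNS hNT hNST) hℓ φ

/-- **`Tr(φ | T_ℓ X) + 2 Tr(φ | T_ℓ B_G) = Tr(φ | T_ℓ B_σ) + 2 Tr(φ | T_ℓ B_τ)`** for a dihedral action with `n` odd.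
[cite: Paulhus2008, §3.1.2 (5) (p. 236)] [cite: KaniRosen1989, Thm. B] [cite: MumfordAV1970, §19 Thm. 4 (p. 180)] -/
theorem trace_tateRep_dihedral_odd [Fintype (Subgroup.zpowers σ)] [Fintype (Subgroup.zpowers τ)]
    (hG : Fintype.card G = 2 * orderOf σ) (hodd : Odd (orderOf σ)) (hτ : orderOf τ = 2) (hστ : τ * σ * τ⁻¹ = σ⁻¹)
    (hN : End.of N = ∑ g, ρ g) (hNS : End.of NS = ∑ h : Subgroup.zpowers σ, ρ h)
    (hNT : End.of NT = ∑ h : Subgroup.zpowers τ, ρ h) (hℓ : (ℓ : K) ≠ 0) (φ : Field.absoluteGaloisGroup K) :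
    LinearMap.trace ℤ_[ℓ] _ (X.tateRep ℓ φ) + 2 * LinearMap.trace ℤ_[ℓ] _ ((image N).tateRep ℓ φ) =
      LinearMap.trace ℤ_[ℓ] _ ((image NS).tateRep ℓ φ) + 2 * LinearMap.trace ℤ_[ℓ] _ ((image NT).tateRep ℓ φ) := by
  have h := trace_tateRep_eq_of_isIsogenous_biprod_three ℓ (isIsogenous_dihedral_odd ρ hG hodd hτ hστ hN hNS hNT) hℓ φ
  linear_combination h

omit [PerfectField K] in
/-- **`P_X · P_{B_G}² = P_{B_σ} · P_{B_τ}²`** for Milne's characteristic polynomials of Frobenius over a finite field, dihedral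
action with `n` odd (`ℓ ∤ q`). [cite: Milne1986AbelianVarieties, §19 Thm. 19.1 and its proof (pp. 144–145)] [cite: Paulhus2008, §3.1.2 (5) (p. 236)] -/
theorem charpoly_frobenius_dihedral_odd [Finite K] [Fintype (Subgroup.zpowers σ)] [Fintype (Subgroup.zpowers τ)]
    (hG : Fintype.card G = 2 * orderOf σ) (hodd : Odd (orderOf σ)) (hτ : orderOf τ = 2) (hστ : τ * σ * τ⁻¹ = σ⁻¹)
    (hN : End.of N = ∑ g, ρ g) (hNS : End.of NS = ∑ h : Subgroup.zpowers σ, ρ h)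
    (hNT : End.of NT = ∑ h : Subgroup.zpowers τ, ρ h) (hℓ : (ℓ : K) ≠ 0) :
    haveI := X.module_free_tateModule_holds ℓ hℓ
    haveI := module_finite_tateModule_of_cast_ne_zero X ℓ hℓ
    haveI := (image N).module_free_tateModule_holds ℓ hℓ
    haveI := module_finite_tateModule_of_cast_ne_zero (image N) ℓ hℓ
    haveI := (image NS).module_free_tateModule_holds ℓ hℓ
    haveI := module_finite_tateModule_of_cast_ne_zero (image NS) ℓ hℓ
    haveI := (image NT).module_free_tateModule_holds ℓ hℓ
    haveI := module_finite_tateModule_of_cast_ne_zero (image NT) ℓ hℓ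
    (tateModuleMap ℓ (frobeniusHom X)).charpoly * (tateModuleMap ℓ (frobeniusHom (image N))).charpoly ^ 2 =
      (tateModuleMap ℓ (frobeniusHom (image NS))).charpoly * (tateModuleMap ℓ (frobeniusHom (image NT))).charpoly ^ 2 := by
  haveI : PerfectField K := PerfectField.ofFinite
  haveI := X.module_free_tateModule_holds ℓ hℓ
  haveI := module_finite_tateModule_of_cast_ne_zero X ℓ hℓ
  haveI := (image N).module_free_tateModule_holds ℓ hℓ
  haveI := module_finite_tateModule_of_cast_ne_zero (image N) ℓ hℓ
  haveI := (image NS).module_free_tateModule_holds ℓ hℓ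
  haveI := module_finite_tateModule_of_cast_ne_zero (image NS) ℓ hℓ
  haveI := (image NT).module_free_tateModule_holds ℓ hℓ
  haveI := module_finite_tateModule_of_cast_ne_zero (image NT) ℓ hℓ
  simp only [charpoly_tateModuleMap_frobeniusHom_eq_charpoly_tateRep]
  exact charpoly_tateRep_dihedral_odd ρ ℓ hG hodd hτ hστ hN hNS hNT hℓ (arithFrob K)

omit [Fact ℓ.Prime] in
/-- **`rk X(L) + 2 rk B_G(L) = rk B_σ(L) + 2 rk B_τ(L)`** (Mordell–Weil ranks) for a dihedral action with `n` odd, when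
`B_G(L) ⊗ ℚ`, `B_σ(L) ⊗ ℚ`, `B_τ(L) ⊗ ℚ` are finite-dimensional (then so is `X(L) ⊗ ℚ`). [cite: Paulhus2008, §3.1.2 (5) (p. 236)]
[cite: KaniRosen1989, Thm. B] [cite: MumfordAV1970, §19 Remark p. 169] [cite: DokchitserEtAl2022, §3 (additive functor lemma)] -/
theorem finrank_points_dihedral_odd [Fintype (Subgroup.zpowers σ)] [Fintype (Subgroup.zpowers τ)]
    (hG : Fintype.card G = 2 * orderOf σ) (hodd : Odd (orderOf σ)) (hτ : orderOf τ = 2) (hστ : τ * σ * τ⁻¹ = σ⁻¹)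
    (hN : End.of N = ∑ g, ρ g) (hNS : End.of NS = ∑ h : Subgroup.zpowers σ, ρ h)
    (hNT : End.of NT = ∑ h : Subgroup.zpowers τ, ρ h) (L : Type u) [Field L] [Algebra K L]
    [Module.Finite ℚ (ℚ ⊗[ℤ] Additive ((image N).Points L))] [Module.Finite ℚ (ℚ ⊗[ℤ] Additive ((image NS).Points L))]
    [Module.Finite ℚ (ℚ ⊗[ℤ] Additive ((image NT).Points L))] :
    Module.finrank ℚ (ℚ ⊗[ℤ] Additive (X.Points L)) + 2 * Module.finrank ℚ (ℚ ⊗[ℤ] Additive ((image N).Points L)) =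
      Module.finrank ℚ (ℚ ⊗[ℤ] Additive ((image NS).Points L)) +
        2 * Module.finrank ℚ (ℚ ⊗[ℤ] Additive ((image NT).Points L)) := by
  have h := finrank_points_eq_of_isIsogenous_biprod_three (isIsogenous_dihedral_odd ρ hG hodd hτ hστ hN hNS hNT) L
  omega

omit [Fact ℓ.Prime] in
/-- **`rk X(L) + 2 rk B_G(L) = rk B_A(L) + 2 rk B_τ(L)`** for a generalized dihedral group `A ⋊ ⟨τ⟩` with `|A|` odd.
[cite: HonigsSarmah2025, §4 Thm. 4.2 (d odd) and Thm. 4.3] [cite: KaniRosen1989, Thm. B] [cite: MumfordAV1970, §19 Remark p. 169] -/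
theorem finrank_points_genDihedral_odd [Fintype (Subgroup.zpowers τ)] (hG : Fintype.card G = 2 * Fintype.card A)
    (hodd : Odd (Fintype.card A)) (hτ : orderOf τ = 2) (hA : ∀ a ∈ A, τ * a * τ⁻¹ = a⁻¹) (hτA : τ ∉ A)
    (hN : End.of N = ∑ g, ρ g) (hNA : End.of NA = ∑ h : A, ρ h) (hNT : End.of NT = ∑ h : Subgroup.zpowers τ, ρ h)
    (L : Type u) [Field L] [Algebra K L] [Module.Finite ℚ (ℚ ⊗[ℤ] Additive ((image N).Points L))]
    [Module.Finite ℚ (ℚ ⊗[ℤ] Additive ((image NA).Points L))] [Module.Finite ℚ (ℚ ⊗[ℤ] Additive ((image NT).Points L))] :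
    Module.finrank ℚ (ℚ ⊗[ℤ] Additive (X.Points L)) + 2 * Module.finrank ℚ (ℚ ⊗[ℤ] Additive ((image N).Points L)) =
      Module.finrank ℚ (ℚ ⊗[ℤ] Additive ((image NA).Points L)) +
        2 * Module.finrank ℚ (ℚ ⊗[ℤ] Additive ((image NT).Points L)) := by
  have h := finrank_points_eq_of_isIsogenous_biprod_three
    (isIsogenous_genDihedral_odd ρ hG hodd hτ hA hτA hN hNA hNT) L
  omega

omit [Fact ℓ.Prime] in
/-- **`rk X(L) + 2 rk B_G(L) = rk B_σ(L) + rk B_τ(L) + rk B_{στ}(L)`** for a dihedral action with `n` even.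
[cite: HonigsSarmah2025, §4 Thm. 4.2 (d even)] [cite: KaniRosen1989, Thm. B] [cite: MumfordAV1970, §19 Remark p. 169] -/
theorem finrank_points_dihedral_even [Fintype (Subgroup.zpowers σ)] [Fintype (Subgroup.zpowers τ)]
    [Fintype (Subgroup.zpowers (σ * τ))] (hG : Fintype.card G = 2 * orderOf σ) (heven : Even (orderOf σ))
    (hτ : orderOf τ = 2) (hστ : τ * σ * τ⁻¹ = σ⁻¹) (hτσ : τ ∉ Subgroup.zpowers σ) (hN : End.of N = ∑ g, ρ g)
    (hNS : End.of NS = ∑ h : Subgroup.zpowers σ, ρ h) (hNT : End.of NT = ∑ h : Subgroup.zpowers τ, ρ h)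
    (hNST : End.of NST = ∑ h : Subgroup.zpowers (σ * τ), ρ h) (L : Type u) [Field L] [Algebra K L]
    [Module.Finite ℚ (ℚ ⊗[ℤ] Additive ((image N).Points L))] [Module.Finite ℚ (ℚ ⊗[ℤ] Additive ((image NS).Points L))]
    [Module.Finite ℚ (ℚ ⊗[ℤ] Additive ((image NT).Points L))]
    [Module.Finite ℚ (ℚ ⊗[ℤ] Additive ((image NST).Points L))] :
    Module.finrank ℚ (ℚ ⊗[ℤ] Additive (X.Points L)) + 2 * Module.finrank ℚ (ℚ ⊗[ℤ] Additive ((image N).Points L)) =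
      Module.finrank ℚ (ℚ ⊗[ℤ] Additive ((image NS).Points L)) +
        (Module.finrank ℚ (ℚ ⊗[ℤ] Additive ((image NT).Points L)) +
          Module.finrank ℚ (ℚ ⊗[ℤ] Additive ((image NST).Points L))) := by
  have h := finrank_points_eq_of_isIsogenous_biprod_three
    (isIsogenous_dihedral_even ρ hG heven hτ hστ hτσ hN hNS hNT hNST) L
  omega

end Dihedral

end AbelianVariety

end Literature.AlgebraicGeometry.Motives
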